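import Summits.QuantumFields.BalabanUV.Beta.D1BFx.FineHessianWardKroneckerBlock
import Summits.QuantumFields.BalabanUV.Beta.D1BFx.FineHessianSectors
import Summits.QuantumFields.BalabanUV.Beta.D1BFx.ReducedKernelPackSplit

/-!
# `BalabanUV.Beta.D1BFx.ReducedKernelPackDiff` — road «BF-x» for binder row D1, slot (K), (S-N) dictionary, (L3) «ΔΛ-ROWS» FILE 1 «ΔΛ-REDUCE»:
# THE REST MEMBER OF A PACK ∕ TABLE DIFFERENCE `restΔ := TOfRed (S+T) (tableRed (Wf+Wf′)) − TOfRed S (tableRed Wf)`, ITS EXPLICIT FINE KERNEL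
# `fineHessΔ`, AND ITS (1.22)-MOMENT IN SLOT-(F) FORM FROM ONE DATUM — FIRST-BOND DIVERGENCE-FREENESS OF `fineHessΔ`

HONEST DEPENDENCY (page 1, mandatory): continuum YM on T⁴ ⇐ BetaPertH ∧ nine spine estimates (0/9 proved); BetaPertH ⇐ (D1) ∧ (D4) ∧
CAP+tail; G-an2-4 gates asym, D1 and NE2/3/4.  HONEST FRAMING (cell contract, verbatim): «discharging `BetaPertH` makes Bałaban's UV
stability UNCONDITIONAL — a real constructive-QFT result; it is NOT the continuum limit and NOT the Clay problem.»  THIS MODULE DISCHARGES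
NOTHING of the wall: TWO bookkeeping definitions with a body ([our object] `fineHessΔ`, `restΔ` — the difference of two LANDED objects) and
[folklore] composition BY NAME of the owner's (L2) `ReducedKernelPackSplit` (the word census), leaf-01's block sandwich
`ReducedKernelSandwichBlock.TOfLeg_tableRedF_eq_dressedEntryP_of_block`, `ReducedKernelSandwich.dressedEntryP_add`, leaf-02's K-R5-from-Ward-data
`FineHessianWardKronecker.bondSecondMomentP_solutionOp_four_of_divFree` (generic `P : EKer₂ 4`), leaf-01's `FineHessianWard.divFree_fineHessA_of_wardLaws`,
`AssemblySlots.secondMoment_eq_avg_fullSum`, `ReducedKernel.absMoment₂_TOfRed`.  No `def … : Prop`, nothing cited, 0 sorry.  The leg binder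
`Spr (Ga n a)`, the localisation ∕ block-covariance ∕ bond-swap sockets of the two systems and the ONE analytic datum `hdivΔ` (first-bond
divergence-freeness of the DIFFERENCE kernel; LINEAR: it follows from the datum for each system, §3) are DISPLAYED hypotheses.  0 wall binders;
(K) NOT closed; NOT D1, NOT `BetaPertH`, NOT continuum, NOT Clay.

ABSOLUTE RULE (cell charter, verbatim): «No internally-minted statement may enter as a cited fact. Every hypothesis is either kernel-proved in
this package or a verbatim quotation of a PUBLISHED theorem with page reference. The manuscript(s) under audit are NOT citable for their own
disputed steps — they are the thing under adjudication; programme-internal (2001/route/tribunal) claims are never citable.»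

WHY (ruling ρ-g15-3 «ΔPACK-AS-REST», memo `OWNER-MEMO-g15.md` §2b; located finding F-gan24leaf05-g49-1).  The literal's pack ∕ table `(S + T,
tableRed n (Wf + Wf′))` differ from the road's `(S, tableRed n Wf)`; by (L2) the discrepancy is three cross∕square bubble words + one tadpole word of
`hptw`'s rest `Rk` (`hMR` there).  Their `hRu` rows need K-R5, and K-R5 needs first-bond divergence-freeness of the word's FINE kernel — which none
of the four fine tables has alone; only their SUM `fineHessΔ := fineHess (S+T) (Wf+Wf′) − fineHess S Wf` has it, LINEARLY.  Hence ONE rest member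
`restΔ`, reduced here from the ONE datum `hdivΔ`; FILES 2–4 of (L3) (the G_Λ dictionary on `fineHessΔ` for a Λ-type `T`, the partner letters, the
row `= 0`) compose on §4.  NOT Λ-specific: any bond-localised block-covariant `T`, any bi-localised jointly-block-covariant bond-swap-symmetric `Wf′`.
CONTENT ([folklore] unless marked; `[NeZero n]`, `G := Ga n a`; ONE common localisation rate `δ`).  §1 [our object] `fineHessΔ`, `restΔ`;
`fineHessΔ_add_fineHess`; **`fineHessΔ_eq_words`** (`= biBubbleTable G G S T + biBubbleTable G G T (S+T) + tadpoleTable n a Wf′` entrywise);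
**`restΔ_eq_words`** (= the (L2) census `TOfRed_add` + `TOfRed_add_table`, GIVEN the reduced table's additivity `hadd`).  §2 `isBlockPeriodic_fineHessΔ`,
`fineHessΔ_transpose`, `absMoment₂_baseKer_fineHessΔ`.  §3 `divFree_fineHessΔ_of_divFree` (`hdiv` of each system ⊢ `hdivΔ`), `divFree_fineHessΔ_of_wardLaws`
((W1)∕(W2) of each system ⊢ `hdivΔ`).  §4 `restΔ_eq_dressedEntryP`; **`bondSecondMoment_restΔ_eq_avgM2_of_divFree`** (K-R5 at `κ, λ ∈ {μ, ν}` from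
`hdivΔ`), `secondMoment_restΔ_eq_of_divFree`, **`hF_restΔ_of_divFree`** (slot (F): `B12Beta.secondMoment (restΔ …) μ ν = Σ_b n⁻⁴·fullSum (w ↦ n⁻⁸·w_μ w_ν·
baseKer (fineHessΔ … μ ν) b w)`), `conv_restΔ` (slot (CONV)), **`absMoment₂_restΔ`** (the member's `hMR`).
Unit `b2b-balaban-gan24-formalise-leaf-05` (gen 49), G-an2-4 swarm leaf prover on road «BF-x» (L3) (first refusal of W-d1p2-g15-6); no existing file touched.
-/

noncomputable section

namespace Summit.QuantumFields.BalabanUV.Beta.D1BFx.ReducedKernelPackDiff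

open Finset Filter Topology
open scoped BigOperators
open Literature.MathematicalPhysics.QuantumFieldTheory
open Literature.MathematicalPhysics.QuantumFieldTheory.Balaban1983to89
open Literature.MathematicalPhysics.QuantumFieldTheory.Balaban1983to89.Beta
open B12Sec2to5 (l1)
open WindowIdentification (fullSum psum)
open DyadicShell (Pt toReal)
open ExpKernelCalculus (Site MKer Decays BiLoc comp shiftK bubble tadpole)
open DecimatedMomentSummable (AbsMoment₂)
open DressedMomentNormalisation (resSite)
open MinimiserIdentityForm (wK absMoment₂_wK)
open KernelWard (divV divW biLoc_add)
open StepDriftWitness (absMoment₂_sub_gen)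
open Summit.QuantumFields.BalabanUV.Beta.TameKernelCalculus (Spr Loc bubble_add_left bubble_add_right tadpole_add)
open Summit.QuantumFields.BalabanUV.Beta.D1BFx.GluonLeg (Ga shiftK_Ga_neg)
open Summit.QuantumFields.BalabanUV.Beta.D1BFx.ReducedKernel (StencilR TableR vertexRed TOfRed vertexFamily_vertexRed' absMoment₂_TOfRed)
open Summit.QuantumFields.BalabanUV.Beta.D1BFx.DressedTadpoleTable (Table₂R tableRed tadpoleTable tadpoleTable_apply)
open Summit.QuantumFields.BalabanUV.Beta.D1BFx.DressedBubbleTable (bubbleTable bubbleTable_apply)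
open Summit.QuantumFields.BalabanUV.Beta.D1BFx.ReducedKernelSandwich (fineHess fineHess_apply absMoment₂_baseKer_fineHess fineHess_transpose
  dressedEntryP_add)
open Summit.QuantumFields.BalabanUV.Beta.D1BFx.ReducedKernelSandwichLeg (fineHessA fineHessA_Ga)
open Summit.QuantumFields.BalabanUV.Beta.D1BFx.ReducedKernelSandwichBlock (isBlockPeriodic_fineHessA_of_block
  TOfLeg_tableRedF_eq_dressedEntryP_of_block)
open Summit.QuantumFields.BalabanUV.Beta.D1BFx.ReducedTableBridge (TOfLeg_tableRedF_eq_TOfRed_tableRed vertexFamily₂_tableRed')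
open Summit.QuantumFields.BalabanUV.Beta.D1BFx.MomentTransferPeriodic (IsBlockPeriodic baseKer)
open Summit.QuantumFields.BalabanUV.Beta.D1BFx.MomentTransferPeriodicEntry (EKer₂ dressedEntryP avgM2)
open Summit.QuantumFields.BalabanUV.Beta.D1BFx.FineHessianWard (divFree_fineHessA_of_wardLaws)
open Summit.QuantumFields.BalabanUV.Beta.D1BFx.FineHessianWardKronecker (bondSecondMomentP_solutionOp_four_of_divFree)
open Summit.QuantumFields.BalabanUV.Beta.FP.PerfectColumnKronecker (divFree_single_of_unitVec)
open Summit.QuantumFields.BalabanUV.Beta.D1BFx.FineHessianSectors (biBubbleTable biBubbleTable_apply)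
open Summit.QuantumFields.BalabanUV.Beta.D1BFx.PackedKernelSplit (biBubble bubble_eq_biBubble)
open Summit.QuantumFields.BalabanUV.Beta.D1BFx.ReducedKernelPackSplit (TOfRed_add TOfRed_add_table)
open Summit.QuantumFields.BalabanUV.Beta.D1BFx.AssemblySlots (secondMoment_eq_avg_fullSum conv_of_absMoment₂)

variable (n : ℕ) [NeZero n] (a : ℝ)

/-! ## §1 The objects and the word census -/

/-- [our object] **THE FINE KERNEL OF THE DIFFERENCE**: `fineHessΔ n a S T Wf Wf′ := fineHess n a (S+T) (Wf+Wf′) − fineHess n a S Wf` entrywise —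
the explicit fine Hessian kernel whose `ℋ`-sandwich is the rest member `restΔ` (§4).  A bookkeeping DEFINITION (difference of two landed objects). -/
def fineHessΔ (S T : StencilR) (Wf Wf' : Table₂R) : EKer₂ 4 :=
  fun κ' l' u u' => fineHess n a (fun κ v => S κ v + T κ v) (fun κ v l v' => Wf κ v l v' + Wf' κ v l v') κ' l' u u'
    - fineHess n a S Wf κ' l' u u'

/-- [our object] **THE REST MEMBER OF A PACK ∕ TABLE DIFFERENCE**: `restΔ n a S T Wf Wf′ μ ν z := TOfRed n a (S+T) (tableRed n (Wf+Wf′)) μ ν z −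
TOfRed n a S (tableRed n Wf) μ ν z` — the ONE member of `hptw`'s `Rk` carrying the literal-minus-road discrepancy (the four (L2) words together,
`restΔ_eq_words`).  A bookkeeping DEFINITION. -/
def restΔ (S T : StencilR) (Wf Wf' : Table₂R) : B12Beta.Kernel 4 :=
  fun μ ν z => TOfRed n a (fun κ v => S κ v + T κ v) (tableRed n (fun κ v l v' => Wf κ v l v' + Wf' κ v l v')) μ ν z
    - TOfRed n a S (tableRed n Wf) μ ν z

variable {S T : StencilR} {Wf Wf' : Table₂R} {Cs Ct C2 C2' δ : ℝ}

/-- [our object] Unfolding. -/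
theorem fineHessΔ_apply (S T : StencilR) (Wf Wf' : Table₂R) (κ' l' : Fin 4) (u u' : Site 4) :
    fineHessΔ n a S T Wf Wf' κ' l' u u' = fineHess n a (fun κ v => S κ v + T κ v) (fun κ v l v' => Wf κ v l v' + Wf' κ v l v') κ' l' u u'
      - fineHess n a S Wf κ' l' u u' := rfl

/-- [our object] Unfolding. -/
theorem restΔ_apply (S T : StencilR) (Wf Wf' : Table₂R) (μ ν : Fin 4) (z : Site 4) :
    restΔ n a S T Wf Wf' μ ν z = TOfRed n a (fun κ v => S κ v + T κ v) (tableRed n (fun κ v l v' => Wf κ v l v' + Wf' κ v l v')) μ ν z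
      - TOfRed n a S (tableRed n Wf) μ ν z := rfl

/-- [folklore] The difference kernel recombines with the road's kernel to the literal's kernel (no hypothesis). -/
theorem fineHessΔ_add_fineHess (S T : StencilR) (Wf Wf' : Table₂R) :
    (fun κ' l' u u' => fineHessΔ n a S T Wf Wf' κ' l' u u' + fineHess n a S Wf κ' l' u u')
      = fineHess n a (fun κ v => S κ v + T κ v) (fun κ v l v' => Wf κ v l v' + Wf' κ v l v') := by
  funext κ' l' u u'
  rw [fineHessΔ_apply, sub_add_cancel]

omit [NeZero n] in
/-- [folklore] A bond-localised stencil family is localised entrywise (`TameKernelCalculus.Loc`). -/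
theorem loc_of_biLoc (hS : ∀ κ u, BiLoc (S κ u) u u Cs δ) (hδ : 0 < δ) (κ : Fin 4) (u : Site 4) : Loc (S κ u) :=
  ⟨u, u, Cs, δ, hδ, hS κ u⟩

/-- [folklore] **THE WORD CENSUS OF THE DIFFERENCE KERNEL**: for the spread gluon leg and localised packs ∕ tables, entrywise
`fineHessΔ = biBubbleTable G G S T + biBubbleTable G G T (S+T) + tadpoleTable n a Wf′` — the cross bubble with `T` in the second slot, the bubble with
`T` in the first slot against the LITERAL's pack `S + T` (cross + square word), and the tadpole of the table difference. -/
theorem fineHessΔ_eq_words (hGa : Spr (Ga n a)) (hS : ∀ κ u, BiLoc (S κ u) u u Cs δ) (hT : ∀ κ u, BiLoc (T κ u) u u Ct δ) (hδ : 0 < δ)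
    (hW : ∀ κ u l u', Loc (Wf κ u l u')) (hW' : ∀ κ u l u', Loc (Wf' κ u l u')) (κ' l' : Fin 4) (u u' : Site 4) :
    fineHessΔ n a S T Wf Wf' κ' l' u u' =
      biBubbleTable (Ga n a) (Ga n a) S T κ' l' u u' + biBubbleTable (Ga n a) (Ga n a) T (fun κ v => S κ v + T κ v) κ' l' u u'
        + tadpoleTable n a Wf' κ' l' u u' := by
  have hLS := loc_of_biLoc hS hδ
  have hLT := loc_of_biLoc hT hδ
  simp only [fineHessΔ_apply, fineHess_apply, tadpoleTable_apply, bubbleTable_apply, biBubbleTable_apply, ← bubble_eq_biBubble]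
  rw [tadpole_add hGa (hW κ' u l' u') (hW' κ' u l' u'),
    bubble_add_left hGa (hLS κ' u) (hLT κ' u) ((hLS l' u').add (hLT l' u')),
    bubble_add_right hGa (hLS κ' u) (hLS l' u') (hLT l' u'), bubble_add_right hGa (hLT κ' u) (hLS l' u') (hLT l' u')]
  ring

/-- [folklore] **THE REST MEMBER IS THE FOUR (L2) WORDS** (`ReducedKernelPackSplit.TOfRed_add` + `TOfRed_add_table`), GIVEN the additivity of the
reduced table (`hadd`, displayed: `tableRed n (Wf + Wf′) = tableRed n Wf + tableRed n Wf′` entrywise — `wsum` linearity under the tables'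
localisation) and the localisation of the two reduced tables:
`restΔ μ ν z = −½·bubble G (vR S μ 0)(vR T ν z) − ½·bubble G (vR T μ 0)(vR S ν z) − ½·bubble G (vR T μ 0)(vR T ν z) + ½·tadpole G (tableRed n Wf′ μ 0 ν z)`. -/
theorem restΔ_eq_words (hGa : Spr (Ga n a)) (hS : ∀ κ u, BiLoc (S κ u) u u Cs δ) (hT : ∀ κ u, BiLoc (T κ u) u u Ct δ) (hδ : 0 < δ)
    (hRW : ∀ μ y ν y', Loc (tableRed n Wf μ y ν y')) (hRW' : ∀ μ y ν y', Loc (tableRed n Wf' μ y ν y'))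
    (hadd : ∀ μ y ν y', tableRed n (fun κ v l v' => Wf κ v l v' + Wf' κ v l v') μ y ν y' = tableRed n Wf μ y ν y' + tableRed n Wf' μ y ν y')
    (μ ν : Fin 4) (z : Site 4) :
    restΔ n a S T Wf Wf' μ ν z =
      -(1 / 2) * bubble (Ga n a) (vertexRed n S μ 0) (vertexRed n T ν z)
        + -(1 / 2) * bubble (Ga n a) (vertexRed n T μ 0) (vertexRed n S ν z)
        + -(1 / 2) * bubble (Ga n a) (vertexRed n T μ 0) (vertexRed n T ν z)
        + (1 / 2) * tadpole (Ga n a) (tableRed n Wf' μ 0 ν z) := by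
  have e : tableRed n (fun κ v l v' => Wf κ v l v' + Wf' κ v l v') = fun μ y ν y' => tableRed n Wf μ y ν y' + tableRed n Wf' μ y ν y' :=
    funext fun μ => funext fun y => funext fun ν => funext fun y' => hadd μ y ν y'
  rw [restΔ_apply, e, TOfRed_add_table n hGa hRW hRW' _ μ ν z, TOfRed_add n hGa hS hδ hT hδ]
  ring

/-! ## §2 Inherited sockets: block periodicity, transposition symmetry, absolutely summable base-point kernels -/

omit [NeZero n] in
/-- [folklore] The sum of two bond-localised stencil families is bond-localised (one rate). -/
theorem biLoc_stencil_add (hS : ∀ κ u, BiLoc (S κ u) u u Cs δ) (hT : ∀ κ u, BiLoc (T κ u) u u Ct δ) (κ : Fin 4) (u : Site 4) :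
    BiLoc ((fun κ v => S κ v + T κ v) κ u) u u (Cs + Ct) δ :=
  biLoc_add (hS κ u) (hT κ u)

omit [NeZero n] in
/-- [folklore] The sum of two bi-localised table families is bi-localised (one rate). -/
theorem biLoc_table_add (hW : ∀ κ u l u', BiLoc (Wf κ u l u') u u' C2 δ) (hW' : ∀ κ u l u', BiLoc (Wf' κ u l u') u u' C2' δ)
    (κ : Fin 4) (u : Site 4) (l : Fin 4) (u' : Site 4) :
    BiLoc ((fun κ v l v' => Wf κ v l v' + Wf' κ v l v') κ u l u') u u' (C2 + C2') δ :=
  biLoc_add (hW κ u l u') (hW' κ u l u')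

omit [NeZero n] in
/-- [folklore] Block covariance of a sum of block-covariant stencil families. -/
theorem stencil_add_translate
    (hScov : ∀ (κ : Fin 4) (u t : Site 4), S κ (u + (n : ℤ) • t) = shiftK (-((n : ℤ) • t)) (S κ u))
    (hTcov : ∀ (κ : Fin 4) (u t : Site 4), T κ (u + (n : ℤ) • t) = shiftK (-((n : ℤ) • t)) (T κ u))
    (κ : Fin 4) (u t : Site 4) :
    (fun κ v => S κ v + T κ v) κ (u + (n : ℤ) • t) = shiftK (-((n : ℤ) • t)) ((fun κ v => S κ v + T κ v) κ u) := by
  simp only [hScov κ u t, hTcov κ u t]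
  rfl

omit [NeZero n] in
/-- [folklore] Joint block covariance of a sum of jointly block-covariant table families. -/
theorem table_add_translate
    (hWcov : ∀ (κ : Fin 4) (u : Site 4) (l : Fin 4) (u' t : Site 4), Wf κ (u + (n : ℤ) • t) l (u' + (n : ℤ) • t) = shiftK (-((n : ℤ) • t)) (Wf κ u l u'))
    (hW'cov : ∀ (κ : Fin 4) (u : Site 4) (l : Fin 4) (u' t : Site 4), Wf' κ (u + (n : ℤ) • t) l (u' + (n : ℤ) • t) = shiftK (-((n : ℤ) • t)) (Wf' κ u l u'))
    (κ : Fin 4) (u : Site 4) (l : Fin 4) (u' t : Site 4) :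
    (fun κ v l v' => Wf κ v l v' + Wf' κ v l v') κ (u + (n : ℤ) • t) l (u' + (n : ℤ) • t)
      = shiftK (-((n : ℤ) • t)) ((fun κ v l v' => Wf κ v l v' + Wf' κ v l v') κ u l u') := by
  simp only [hWcov κ u l u' t, hW'cov κ u l u' t]
  rfl

/-- [folklore] **BLOCK PERIODICITY** of every entry of the difference kernel (`n ≥ 1`; block covariance of `S`, `T`, joint block covariance of `Wf`, `Wf′`). -/
theorem isBlockPeriodic_fineHessΔ (hn : 1 ≤ n)
    (hScov : ∀ (κ : Fin 4) (u t : Site 4), S κ (u + (n : ℤ) • t) = shiftK (-((n : ℤ) • t)) (S κ u))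
    (hTcov : ∀ (κ : Fin 4) (u t : Site 4), T κ (u + (n : ℤ) • t) = shiftK (-((n : ℤ) • t)) (T κ u))
    (hWcov : ∀ (κ : Fin 4) (u : Site 4) (l : Fin 4) (u' t : Site 4), Wf κ (u + (n : ℤ) • t) l (u' + (n : ℤ) • t) = shiftK (-((n : ℤ) • t)) (Wf κ u l u'))
    (hW'cov : ∀ (κ : Fin 4) (u : Site 4) (l : Fin 4) (u' t : Site 4), Wf' κ (u + (n : ℤ) • t) l (u' + (n : ℤ) • t) = shiftK (-((n : ℤ) • t)) (Wf' κ u l u'))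
    (κ' l' : Fin 4) : IsBlockPeriodic n (fineHessΔ n a S T Wf Wf' κ' l') := by
  intro t s s'
  have h1 := isBlockPeriodic_fineHessA_of_block n (Ga n a) (S := fun κ v => S κ v + T κ v)
    (Wf := fun κ v l v' => Wf κ v l v' + Wf' κ v l v') (shiftK_Ga_neg n a hn) (stencil_add_translate n hScov hTcov)
    (table_add_translate n hWcov hW'cov) κ' l' t s s'
  have h2 := isBlockPeriodic_fineHessA_of_block n (Ga n a) (shiftK_Ga_neg n a hn) hScov hWcov κ' l' t s s'
  rw [fineHessA_Ga] at h1 h2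
  simp only [fineHessΔ_apply, h1, h2]

/-- [folklore] **TRANSPOSITION SYMMETRY** of the difference kernel for bond-swap-symmetric tables: `fineHessΔ κ′λ′ u u′ = fineHessΔ λ′κ′ u′ u`. -/
theorem fineHessΔ_transpose (hGa : Spr (Ga n a)) (hS : ∀ κ u, BiLoc (S κ u) u u Cs δ) (hT : ∀ κ u, BiLoc (T κ u) u u Ct δ) (hδ : 0 < δ)
    (hWs : ∀ (κ : Fin 4) (u : Site 4) (l : Fin 4) (u' : Site 4), Wf κ u l u' = Wf l u' κ u)
    (hW's : ∀ (κ : Fin 4) (u : Site 4) (l : Fin 4) (u' : Site 4), Wf' κ u l u' = Wf' l u' κ u)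
    (κ' l' : Fin 4) (u u' : Site 4) : fineHessΔ n a S T Wf Wf' κ' l' u u' = fineHessΔ n a S T Wf Wf' l' κ' u' u := by
  have hsum : ∀ (κ : Fin 4) (u : Site 4) (l : Fin 4) (u' : Site 4),
      (fun κ v l v' => Wf κ v l v' + Wf' κ v l v') κ u l u' = (fun κ v l v' => Wf κ v l v' + Wf' κ v l v') l u' κ u := fun κ u l u' => by
    simp only [hWs κ u l u', hW's κ u l u']
  rw [fineHessΔ_apply, fineHessΔ_apply, fineHess_transpose n a hGa (biLoc_stencil_add hS hT) hδ hsum κ' l' u u',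
    fineHess_transpose n a hGa hS hδ hWs κ' l' u u']

/-- [folklore] **ABSOLUTELY SUMMABLE BASE-POINT KERNELS** of the difference kernel (`Spr G`; the four families localised at one rate). -/
theorem absMoment₂_baseKer_fineHessΔ (hGa : Spr (Ga n a)) (hS : ∀ κ u, BiLoc (S κ u) u u Cs δ) (hT : ∀ κ u, BiLoc (T κ u) u u Ct δ)
    (hW : ∀ κ u l u', BiLoc (Wf κ u l u') u u' C2 δ) (hW' : ∀ κ u l u', BiLoc (Wf' κ u l u') u u' C2' δ) (hδ : 0 < δ)
    (κ' l' : Fin 4) (b : Site 4) : AbsMoment₂ (baseKer (fineHessΔ n a S T Wf Wf' κ' l') b) := by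
  have h1 := absMoment₂_baseKer_fineHess n a hGa (biLoc_stencil_add hS hT) (biLoc_table_add hW hW') hδ κ' l' b
  have h2 := absMoment₂_baseKer_fineHess n a hGa hS hW hδ κ' l' b
  exact (absMoment₂_sub_gen h1 h2).congr fun t => rfl

/-! ## §3 The one datum: first-bond divergence-freeness of the difference kernel is LINEAR -/

/-- [folklore] **`hdivΔ` FROM THE DATUM OF EACH SYSTEM**: if the literal's kernel `fineHess (S+T) (Wf+Wf′)` and the road's kernel `fineHess S Wf` are
both divergence-free in the first bond then so is their difference (no other hypothesis). -/
theorem divFree_fineHessΔ_of_divFree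
    (hdiv' : ∀ (l' : Fin 4) (u' u : Site 4), ∑ κ' : Fin 4,
      (fineHess n a (fun κ v => S κ v + T κ v) (fun κ v l v' => Wf κ v l v' + Wf' κ v l v') κ' l' (u - Pi.single κ' 1) u'
        - fineHess n a (fun κ v => S κ v + T κ v) (fun κ v l v' => Wf κ v l v' + Wf' κ v l v') κ' l' u u') = 0)
    (hdiv : ∀ (l' : Fin 4) (u' u : Site 4),
      ∑ κ' : Fin 4, (fineHess n a S Wf κ' l' (u - Pi.single κ' 1) u' - fineHess n a S Wf κ' l' u u') = 0)
    (l' : Fin 4) (u' u : Site 4) :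
    ∑ κ' : Fin 4, (fineHessΔ n a S T Wf Wf' κ' l' (u - Pi.single κ' 1) u' - fineHessΔ n a S T Wf Wf' κ' l' u u') = 0 := by
  have h : (∑ κ' : Fin 4,
      (fineHess n a (fun κ v => S κ v + T κ v) (fun κ v l v' => Wf κ v l v' + Wf' κ v l v') κ' l' (u - Pi.single κ' 1) u'
        - fineHess n a (fun κ v => S κ v + T κ v) (fun κ v l v' => Wf κ v l v' + Wf' κ v l v') κ' l' u u'))
      - ∑ κ' : Fin 4, (fineHess n a S Wf κ' l' (u - Pi.single κ' 1) u' - fineHess n a S Wf κ' l' u u') = 0 := by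
    rw [hdiv' l' u' u, hdiv l' u' u, sub_zero]
  rw [← Finset.sum_sub_distrib] at h
  rw [← h]
  refine Finset.sum_congr rfl fun κ' _ => ?_
  simp only [fineHessΔ_apply]
  ring

/-- [folklore] **`hdivΔ` FROM THE WARD LAWS OF EACH SYSTEM**: bi-localised gauge generators `X` (road) and `X′` (literal) with
(W1) `(G ∘ divV S u) ∘ G = G ∘ X u − X u ∘ G`, (W2) `divW Wf u λ′ u′ = X u ∘ S λ′ u′ − S λ′ u′ ∘ X u` and the same for `(S+T, Wf+Wf′, X′)` ⟹ `hdivΔ`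
(leaf-01's `FineHessianWard.divFree_fineHessA_of_wardLaws` twice, then linearity). -/
theorem divFree_fineHessΔ_of_wardLaws (hGa : Spr (Ga n a)) (hS : ∀ κ u, BiLoc (S κ u) u u Cs δ) (hT : ∀ κ u, BiLoc (T κ u) u u Ct δ)
    (hW : ∀ κ u l u', BiLoc (Wf κ u l u') u u' C2 δ) (hW' : ∀ κ u l u', BiLoc (Wf' κ u l u') u u' C2' δ) (hδ : 0 < δ)
    {X X' : Site 4 → MKer 4 (Fin 4)} {Cx Cx' : ℝ} (hX : ∀ u, BiLoc (X u) u u Cx δ) (hX' : ∀ u, BiLoc (X' u) u u Cx' δ)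
    (hW1 : ∀ u, comp (comp (Ga n a) (divV S u)) (Ga n a) = comp (Ga n a) (X u) - comp (X u) (Ga n a))
    (hW2 : ∀ (u : Site 4) (l' : Fin 4) (u' : Site 4), divW Wf u l' u' = comp (X u) (S l' u') - comp (S l' u') (X u))
    (hW1' : ∀ u, comp (comp (Ga n a) (divV (fun κ v => S κ v + T κ v) u)) (Ga n a) = comp (Ga n a) (X' u) - comp (X' u) (Ga n a))
    (hW2' : ∀ (u : Site 4) (l' : Fin 4) (u' : Site 4), divW (fun κ v l v' => Wf κ v l v' + Wf' κ v l v') u l' u'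
      = comp (X' u) ((fun κ v => S κ v + T κ v) l' u') - comp ((fun κ v => S κ v + T κ v) l' u') (X' u))
    (l' : Fin 4) (u' u : Site 4) :
    ∑ κ' : Fin 4, (fineHessΔ n a S T Wf Wf' κ' l' (u - Pi.single κ' 1) u' - fineHessΔ n a S T Wf Wf' κ' l' u u') = 0 := by
  refine divFree_fineHessΔ_of_divFree n a (fun e v' v => ?_) (fun e v' v => ?_) l' u' u
  · have h := divFree_single_of_unitVec
      (divFree_fineHessA_of_wardLaws (Ga n a) X' hGa (biLoc_stencil_add hS hT) (biLoc_table_add hW hW') hX' hδ hW1' hW2') e v' v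
    rwa [fineHessA_Ga] at h
  · have h := divFree_single_of_unitVec (divFree_fineHessA_of_wardLaws (Ga n a) X hGa hS hW hX hδ hW1 hW2) e v' v
    rwa [fineHessA_Ga] at h

/-! ## §4 The sandwich, K-R5 from `hdivΔ`, slots (F) ∕ (CONV), and the `hMR` row -/

/-- [folklore] The road's sandwich identity at BLOCK covariance, read on A4's objects: `TOfRed n a S (tableRed n Wf) μ ν z =
dressedEntryP (wK n) (fineHess n a S Wf) (n•(−z)) μ ν` (leaf-01's `TOfLeg_tableRedF_eq_dressedEntryP_of_block` + the bridge). -/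
theorem TOfRed_tableRed_eq_dressedEntryP_of_block (hn : 1 ≤ n) (hGa : Spr (Ga n a)) (hS : ∀ κ u, BiLoc (S κ u) u u Cs δ)
    (hW : ∀ κ u l u', BiLoc (Wf κ u l u') u u' C2 δ) (hδ : 0 < δ)
    (hScov : ∀ (κ : Fin 4) (u t : Site 4), S κ (u + (n : ℤ) • t) = shiftK (-((n : ℤ) • t)) (S κ u))
    (hWcov : ∀ (κ : Fin 4) (u : Site 4) (l : Fin 4) (u' t : Site 4), Wf κ (u + (n : ℤ) • t) l (u' + (n : ℤ) • t) = shiftK (-((n : ℤ) • t)) (Wf κ u l u'))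
    (μ ν : Fin 4) (z : Site 4) :
    TOfRed n a S (tableRed n Wf) μ ν z = dressedEntryP (wK n) (fineHess n a S Wf) ((n : ℤ) • (-z)) μ ν := by
  have h := TOfLeg_tableRedF_eq_dressedEntryP_of_block n (Ga n a) hGa (shiftK_Ga_neg n a hn) hS hW hδ hScov hWcov μ ν z
  rwa [TOfLeg_tableRedF_eq_TOfRed_tableRed n a S hW hδ, fineHessA_Ga] at h

/-- [folklore] **THE REST MEMBER IS THE `ℋ`-SANDWICH OF THE DIFFERENCE KERNEL**:
`restΔ n a S T Wf Wf′ μ ν z = dressedEntryP (wK n) (fineHessΔ n a S T Wf Wf′) (n•(−z)) μ ν`. -/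
theorem restΔ_eq_dressedEntryP (hn : 1 ≤ n) (hGa : Spr (Ga n a)) (hS : ∀ κ u, BiLoc (S κ u) u u Cs δ) (hT : ∀ κ u, BiLoc (T κ u) u u Ct δ)
    (hW : ∀ κ u l u', BiLoc (Wf κ u l u') u u' C2 δ) (hW' : ∀ κ u l u', BiLoc (Wf' κ u l u') u u' C2' δ) (hδ : 0 < δ)
    (hScov : ∀ (κ : Fin 4) (u t : Site 4), S κ (u + (n : ℤ) • t) = shiftK (-((n : ℤ) • t)) (S κ u))
    (hTcov : ∀ (κ : Fin 4) (u t : Site 4), T κ (u + (n : ℤ) • t) = shiftK (-((n : ℤ) • t)) (T κ u))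
    (hWcov : ∀ (κ : Fin 4) (u : Site 4) (l : Fin 4) (u' t : Site 4), Wf κ (u + (n : ℤ) • t) l (u' + (n : ℤ) • t) = shiftK (-((n : ℤ) • t)) (Wf κ u l u'))
    (hW'cov : ∀ (κ : Fin 4) (u : Site 4) (l : Fin 4) (u' t : Site 4), Wf' κ (u + (n : ℤ) • t) l (u' + (n : ℤ) • t) = shiftK (-((n : ℤ) • t)) (Wf' κ u l u'))
    (μ ν : Fin 4) (z : Site 4) :
    restΔ n a S T Wf Wf' μ ν z = dressedEntryP (wK n) (fineHessΔ n a S T Wf Wf') ((n : ℤ) • (-z)) μ ν := by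
  have hlit := TOfRed_tableRed_eq_dressedEntryP_of_block n a hn hGa (biLoc_stencil_add hS hT) (biLoc_table_add hW hW') hδ
    (stencil_add_translate n hScov hTcov) (table_add_translate n hWcov hW'cov) μ ν z
  have hroad := TOfRed_tableRed_eq_dressedEntryP_of_block n a hn hGa hS hW hδ hScov hWcov μ ν z
  have hadd := dressedEntryP_add (Nat.pos_of_ne_zero (NeZero.ne n)) (wK n) (fineHessΔ n a S T Wf Wf') (fineHess n a S Wf) absMoment₂_wK
    (isBlockPeriodic_fineHessΔ n a hn hScov hTcov hWcov hW'cov)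
    (fun c e => by
      have h := isBlockPeriodic_fineHessA_of_block n (Ga n a) (shiftK_Ga_neg n a hn) hScov hWcov c e
      rwa [fineHessA_Ga] at h)
    (absMoment₂_baseKer_fineHessΔ n a hGa hS hT hW hW' hδ) (absMoment₂_baseKer_fineHess n a hGa hS hW hδ) ((n : ℤ) • (-z)) μ ν
  rw [fineHessΔ_add_fineHess] at hadd
  rw [restΔ_apply, hlit, hroad, hadd, add_sub_cancel_right]

/-- [folklore] **K-R5 FOR THE REST MEMBER FROM ONE DATUM** — at the entries `κ, λ ∈ {μ, ν}`:
`Σ'_z z_κ z_λ · n⁸ · restΔ … μ ν z = avgM2 n (fineHessΔ … μ ν) κ λ`, GIVEN `hdivΔ` (first-bond divergence-freeness of `fineHessΔ`) — ONE line over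
leaf-02's `bondSecondMomentP_solutionOp_four_of_divFree` (generic block-periodic transposition-symmetric `P` with summable base-point kernels). -/
theorem bondSecondMoment_restΔ_eq_avgM2_of_divFree (hn : 1 ≤ n) (hGa : Spr (Ga n a)) (hS : ∀ κ u, BiLoc (S κ u) u u Cs δ)
    (hT : ∀ κ u, BiLoc (T κ u) u u Ct δ) (hW : ∀ κ u l u', BiLoc (Wf κ u l u') u u' C2 δ) (hW' : ∀ κ u l u', BiLoc (Wf' κ u l u') u u' C2' δ)
    (hδ : 0 < δ)
    (hScov : ∀ (κ : Fin 4) (u t : Site 4), S κ (u + (n : ℤ) • t) = shiftK (-((n : ℤ) • t)) (S κ u))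
    (hTcov : ∀ (κ : Fin 4) (u t : Site 4), T κ (u + (n : ℤ) • t) = shiftK (-((n : ℤ) • t)) (T κ u))
    (hWcov : ∀ (κ : Fin 4) (u : Site 4) (l : Fin 4) (u' t : Site 4), Wf κ (u + (n : ℤ) • t) l (u' + (n : ℤ) • t) = shiftK (-((n : ℤ) • t)) (Wf κ u l u'))
    (hW'cov : ∀ (κ : Fin 4) (u : Site 4) (l : Fin 4) (u' t : Site 4), Wf' κ (u + (n : ℤ) • t) l (u' + (n : ℤ) • t) = shiftK (-((n : ℤ) • t)) (Wf' κ u l u'))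
    (hWs : ∀ (κ : Fin 4) (u : Site 4) (l : Fin 4) (u' : Site 4), Wf κ u l u' = Wf l u' κ u)
    (hW's : ∀ (κ : Fin 4) (u : Site 4) (l : Fin 4) (u' : Site 4), Wf' κ u l u' = Wf' l u' κ u)
    (hdivΔ : ∀ (l' : Fin 4) (u' u : Site 4), ∑ κ' : Fin 4, (fineHessΔ n a S T Wf Wf' κ' l' (u - Pi.single κ' 1) u' - fineHessΔ n a S T Wf Wf' κ' l' u u') = 0)
    {κ lam μ ν : Fin 4} (hκ : κ = μ ∨ κ = ν) (hlam : lam = μ ∨ lam = ν) :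
    ∑' z : Site 4, ((z κ * z lam : ℤ) : ℝ) * ((n : ℝ) ^ 8 * restΔ n a S T Wf Wf' μ ν z)
      = avgM2 n (fineHessΔ n a S T Wf Wf' μ ν) κ lam := by
  have h := bondSecondMomentP_solutionOp_four_of_divFree (N := n) (fineHessΔ n a S T Wf Wf')
    (isBlockPeriodic_fineHessΔ n a hn hScov hTcov hWcov hW'cov) (fineHessΔ_transpose n a hGa hS hT hδ hWs hW's) hdivΔ
    (absMoment₂_baseKer_fineHessΔ n a hGa hS hT hW hW' hδ) hκ hlam
  rw [← h, ← (Equiv.neg (Site 4)).tsum_eq]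
  refine tsum_congr fun z => ?_
  rw [restΔ_eq_dressedEntryP n a hn hGa hS hT hW hW' hδ hScov hTcov hWcov hW'cov μ ν]
  simp only [Equiv.neg_apply, Pi.neg_apply, neg_mul_neg, neg_neg]

/-- [folklore] The same in `B12Beta.secondMoment` currency: `Σ'_z restΔ … μ ν z · z_κ · z_λ = n⁻⁸ · avgM2 n (fineHessΔ … μ ν) κ λ` (`κ, λ ∈ {μ, ν}`). -/
theorem secondMoment_restΔ_eq_of_divFree (hn : 1 ≤ n) (hGa : Spr (Ga n a)) (hS : ∀ κ u, BiLoc (S κ u) u u Cs δ)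
    (hT : ∀ κ u, BiLoc (T κ u) u u Ct δ) (hW : ∀ κ u l u', BiLoc (Wf κ u l u') u u' C2 δ) (hW' : ∀ κ u l u', BiLoc (Wf' κ u l u') u u' C2' δ)
    (hδ : 0 < δ)
    (hScov : ∀ (κ : Fin 4) (u t : Site 4), S κ (u + (n : ℤ) • t) = shiftK (-((n : ℤ) • t)) (S κ u))
    (hTcov : ∀ (κ : Fin 4) (u t : Site 4), T κ (u + (n : ℤ) • t) = shiftK (-((n : ℤ) • t)) (T κ u))
    (hWcov : ∀ (κ : Fin 4) (u : Site 4) (l : Fin 4) (u' t : Site 4), Wf κ (u + (n : ℤ) • t) l (u' + (n : ℤ) • t) = shiftK (-((n : ℤ) • t)) (Wf κ u l u'))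
    (hW'cov : ∀ (κ : Fin 4) (u : Site 4) (l : Fin 4) (u' t : Site 4), Wf' κ (u + (n : ℤ) • t) l (u' + (n : ℤ) • t) = shiftK (-((n : ℤ) • t)) (Wf' κ u l u'))
    (hWs : ∀ (κ : Fin 4) (u : Site 4) (l : Fin 4) (u' : Site 4), Wf κ u l u' = Wf l u' κ u)
    (hW's : ∀ (κ : Fin 4) (u : Site 4) (l : Fin 4) (u' : Site 4), Wf' κ u l u' = Wf' l u' κ u)
    (hdivΔ : ∀ (l' : Fin 4) (u' u : Site 4), ∑ κ' : Fin 4, (fineHessΔ n a S T Wf Wf' κ' l' (u - Pi.single κ' 1) u' - fineHessΔ n a S T Wf Wf' κ' l' u u') = 0)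
    {κ lam μ ν : Fin 4} (hκ : κ = μ ∨ κ = ν) (hlam : lam = μ ∨ lam = ν) :
    ∑' z : Site 4, restΔ n a S T Wf Wf' μ ν z * (z κ : ℝ) * (z lam : ℝ)
      = ((n : ℝ) ^ 8)⁻¹ * avgM2 n (fineHessΔ n a S T Wf Wf' μ ν) κ lam := by
  have hn' : (n : ℝ) ^ 8 ≠ 0 := pow_ne_zero 8 (by exact_mod_cast NeZero.ne n)
  have h := bondSecondMoment_restΔ_eq_avgM2_of_divFree n a hn hGa hS hT hW hW' hδ hScov hTcov hWcov hW'cov hWs hW's hdivΔ hκ hlam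
  have e : (fun z : Site 4 => ((z κ * z lam : ℤ) : ℝ) * ((n : ℝ) ^ 8 * restΔ n a S T Wf Wf' μ ν z))
      = fun z => (n : ℝ) ^ 8 * (restΔ n a S T Wf Wf' μ ν z * (z κ : ℝ) * (z lam : ℝ)) := by
    funext z
    push_cast
    ring
  rw [e, tsum_mul_left] at h
  rw [← h, ← mul_assoc, inv_mul_cancel₀ hn', one_mul]

/-- [folklore] **SLOT (F) FOR THE REST MEMBER FROM ONE DATUM**: `B12Beta.secondMoment (restΔ …) μ ν` EQUALS the uniform base-point average over the
residue sites of `n⁻⁴·fullSum` of the fine integrand `w ↦ n⁻⁸·w_μ·w_ν·baseKer (fineHessΔ … μ ν) b w` — the input of (L3) FILE 2 «ΔΛ-DICT». -/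
theorem hF_restΔ_of_divFree (hn : 1 ≤ n) (hGa : Spr (Ga n a)) (hS : ∀ κ u, BiLoc (S κ u) u u Cs δ)
    (hT : ∀ κ u, BiLoc (T κ u) u u Ct δ) (hW : ∀ κ u l u', BiLoc (Wf κ u l u') u u' C2 δ) (hW' : ∀ κ u l u', BiLoc (Wf' κ u l u') u u' C2' δ)
    (hδ : 0 < δ)
    (hScov : ∀ (κ : Fin 4) (u t : Site 4), S κ (u + (n : ℤ) • t) = shiftK (-((n : ℤ) • t)) (S κ u))
    (hTcov : ∀ (κ : Fin 4) (u t : Site 4), T κ (u + (n : ℤ) • t) = shiftK (-((n : ℤ) • t)) (T κ u))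
    (hWcov : ∀ (κ : Fin 4) (u : Site 4) (l : Fin 4) (u' t : Site 4), Wf κ (u + (n : ℤ) • t) l (u' + (n : ℤ) • t) = shiftK (-((n : ℤ) • t)) (Wf κ u l u'))
    (hW'cov : ∀ (κ : Fin 4) (u : Site 4) (l : Fin 4) (u' t : Site 4), Wf' κ (u + (n : ℤ) • t) l (u' + (n : ℤ) • t) = shiftK (-((n : ℤ) • t)) (Wf' κ u l u'))
    (hWs : ∀ (κ : Fin 4) (u : Site 4) (l : Fin 4) (u' : Site 4), Wf κ u l u' = Wf l u' κ u)
    (hW's : ∀ (κ : Fin 4) (u : Site 4) (l : Fin 4) (u' : Site 4), Wf' κ u l u' = Wf' l u' κ u)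
    (hdivΔ : ∀ (l' : Fin 4) (u' u : Site 4), ∑ κ' : Fin 4, (fineHessΔ n a S T Wf Wf' κ' l' (u - Pi.single κ' 1) u' - fineHessΔ n a S T Wf Wf' κ' l' u u') = 0)
    (μ ν : Fin 4) :
    B12Beta.secondMoment (restΔ n a S T Wf Wf') μ ν =
      ∑ b ∈ (univ : Finset (Fin 4 → Fin n)).image resSite, ((n : ℝ) ^ 4)⁻¹ *
        fullSum (fun w : Pt => ((n : ℝ) ^ 8)⁻¹ * (toReal w μ * toReal w ν * baseKer (fineHessΔ n a S T Wf Wf' μ ν) b w)) :=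
  secondMoment_eq_avg_fullSum
    (secondMoment_restΔ_eq_of_divFree n a hn hGa hS hT hW hW' hδ hScov hTcov hWcov hW'cov hWs hW's hdivΔ
      (κ := μ) (lam := ν) (μ := μ) (ν := ν) (Or.inl rfl) (Or.inr rfl))
    fun r => absMoment₂_baseKer_fineHessΔ n a hGa hS hT hW hW' hδ μ ν (resSite r)

/-- [folklore] **SLOT (CONV) FOR THE REST MEMBER** from the leg binder and the localisation sockets ONLY (no Ward input). -/
theorem conv_restΔ (hGa : Spr (Ga n a)) (hS : ∀ κ u, BiLoc (S κ u) u u Cs δ) (hT : ∀ κ u, BiLoc (T κ u) u u Ct δ)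
    (hW : ∀ κ u l u', BiLoc (Wf κ u l u') u u' C2 δ) (hW' : ∀ κ u l u', BiLoc (Wf' κ u l u') u u' C2' δ) (hδ : 0 < δ) (μ ν : Fin 4) :
    ∀ b ∈ (univ : Finset (Fin 4 → Fin n)).image resSite,
      ∃ B, Tendsto (psum (fun w : Pt => ((n : ℝ) ^ 8)⁻¹ * (toReal w μ * toReal w ν * baseKer (fineHessΔ n a S T Wf Wf' μ ν) b w)))
        atTop (𝓝 B) :=
  conv_of_absMoment₂ (fun r => absMoment₂_baseKer_fineHessΔ n a hGa hS hT hW hW' hδ μ ν (resSite r)) μ ν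

/-- [folklore] **THE `hMR` ROW OF THE REST MEMBER**: `AbsMoment₂ (restΔ … μ ν)` from the leg binder and the localisation sockets (T8's
`ReducedKernel.absMoment₂_TOfRed` for the literal and the road, `vertexFamily_vertexRed'`, `ReducedTableBridge.vertexFamily₂_tableRed'`). -/
theorem absMoment₂_restΔ (hn : 1 ≤ n) (hGa : Spr (Ga n a)) (hS : ∀ κ u, BiLoc (S κ u) u u Cs δ) (hT : ∀ κ u, BiLoc (T κ u) u u Ct δ)
    (hW : ∀ κ u l u', BiLoc (Wf κ u l u') u u' C2 δ) (hW' : ∀ κ u l u', BiLoc (Wf' κ u l u') u u' C2' δ) (hδ : 0 < δ) (μ ν : Fin 4) :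
    AbsMoment₂ (restΔ n a S T Wf Wf' μ ν) := by
  obtain ⟨C, δA, hδA, hGd⟩ := hGa
  obtain ⟨Cv, δv, hδv, -, hV⟩ := vertexFamily_vertexRed' n (biLoc_stencil_add hS hT) hδ
  obtain ⟨Cv₀, δv₀, hδv₀, -, hV₀⟩ := vertexFamily_vertexRed' n hS hδ
  obtain ⟨Cw, δ2, hδ2, -, hWv⟩ := vertexFamily₂_tableRed' n (biLoc_table_add hW hW') hδ
  obtain ⟨Cw₀, δ2₀, hδ2₀, -, hWv₀⟩ := vertexFamily₂_tableRed' n hW hδ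
  have h1 := absMoment₂_TOfRed n a hn hGd hδA hV hδv hWv hδ2 μ ν
  have h2 := absMoment₂_TOfRed n a hn hGd hδA hV₀ hδv₀ hWv₀ hδ2₀ μ ν
  exact (absMoment₂_sub_gen h1 h2).congr fun z => rfl

end Summit.QuantumFields.BalabanUV.Beta.D1BFx.ReducedKernelPackDiff

end
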